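import Literature.NumberTheory.ComplexMultiplication.CMTypeRankIrreducibleSlot
import HarnessLib

/-!
# The REFLEX SLOT of a CM type: the embeddings of the reflex field as the Galois translates of the type

Theorems only, no definition, no named fact.  Abstract setting of `Literature/NumberTheory/ComplexMultiplication/CMTypeRank`
(a group `G` acting on a set `Z` of "embeddings", a commuting fixed-point-free involution `ρ`, a CM type `Φ₀ ⊆ Z`,
`IsCMTypeWith ρ Φ₀`) together with a SECOND `G`-set `Y` — in the application `Z = Hom(K, ℂ)` for a CM field `K` with a
CM type `Φ₀`, and `Y = Hom(K_F, ℂ)` for a CM field `K_F` ISOMORPHIC TO THE REFLEX FIELD `K*` of `(K, Φ₀)`: an embedding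
`ψ₀ : K_F → ℂ` with `ψ₀(K_F) = K*` has the same fixer in `Aut(ℂ)` as the type `Φ₀` (Shimura 1998 §8.3 Prop. 28: "the
reflex field is the subfield corresponding to `{γ | γΦ = Φ}`"), so that `Hom(K_F, ℂ) = Aut(ℂ)·ψ₀ ≅ Aut(ℂ)/Stab(Φ₀) ≅
Aut(ℂ)·Φ₀`, the set of Galois translates of `Φ₀` (Dodson 1984, §1, Remark after the Reflex Degree Theorem: "`[K' : ℚ]`
is also the order of the orbit of `Φ` under the `G`-action").

The identification is recorded as a map `T : Y → Set Z` ("the type attached to an embedding of the reflex field",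
`T(σψ₀) = σΦ₀`) subject to three axioms — EQUIVARIANCE `x ∈ T(g y) ⟺ g⁻¹x ∈ T(y)`, INJECTIVITY, and the base point
`T(y₀) = Φ₀` — plus transitivity of `G` on `Y`.  Contents (all elementary):

* `exists_typeMap` — such a `T` EXISTS as soon as `Stab(y₀) = Stab(Φ₀)` and `G` is transitive on `Y` (the
  number-field situation above);
* `isCMTypeWith_typeMap` — every `T(y)` is a CM type; `mem_typeMap_rho_smul_iff` — `T(ρy) = Z ∖ T(y)` (complex
  conjugation on the reflex field is the passage to the conjugate type);
* `smul_eq_smul_of_forall_smul_eq` — two elements of `G` acting alike on `Z` act alike on `Y` (the action on the reflex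
  field factors through the Galois group of the closure of `K`); hence `ρ` is a commuting fixed-point-free involution on
  `Y` (`rho_smul_rho_smul`, `smul_rho_smul_comm`, `rho_smul_ne`);
* `eq_of_forall_mem_typeMap_iff` — a point of `Y` is determined by its COORDINATES `(x ∈ T y)_{x ∈ Φ₀}`
  (a Galois translate of `Φ₀` is determined by its trace on `Φ₀`);
* `mem_typeMap_iff_of_smul_eq` / `mem_typeMap_smul_iff_of_smul_eq_rho` — the coordinates of `φ y` for an element `φ`
  fixing or flipping the pair `{x, ρx}`.

These are the bookkeeping lemmas behind the rank computation for a CM field with pair flips against its reflex field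
(Summits-side `CorCM/PairFlipSexticReflexSlotRank`, `CorCM/PairFlipSexticTimesReflexOcticHodge`).

## References

* [Shimura1998] G. Shimura, *Abelian Varieties with Complex Multiplication and Modular Functions*, §8.3 Prop. 28.
* [Dodson1984] B. Dodson, *The structure of Galois groups of CM-fields*, Trans. AMS 283 (1984), §1 (The Reflex Degree
  Theorem and the Remark following it).
* [MilneCM2006] J. S. Milne, *Complex Multiplication*, Ch. I §1, Prop. 1.16–1.18.

Provenance: Literature home (family `hodge`) of the Summits-side `CorCM/ReflexSlotIncidence` (cell `pub-hodgecm2` ∕ `pub-hodge-ring2`; all its imports are `Literature/` and Mathlib), which `Literature/` may not import; theorems only, no named fact, no definition. Nothing here bears on `HC_CM`; no case of the Hodge conjecture beyond the stated unconditional ones is claimed. Lane `lit-hodgefound` (Layer A2/A3: polarizations, CM types, reflex fields, Hodge and Mumford–Tate groups), seat p20.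
-/

set_option autoImplicit false

namespace Literature.NumberTheory.ComplexMultiplication

namespace ReflexSlot

open Literature.NumberTheory.ComplexMultiplication

variable {G : Type*} [Group G] {Z Y : Type*} [MulAction G Z] [MulAction G Y] {ρ : G} {Φ₀ : Set Z}
  {T : Y → Set Z} {y₀ : Y}

/-! ### §1 Existence of the type map from the stabiliser identity -/

/-- **The reflex slot.**  If the fixer of `y₀` in `G` is the stabiliser of the CM type `Φ₀` (`ψ₀(K_F)` is the reflex
field of `(K, Φ₀)`) and `G` is transitive on `Y`, then `y = σy₀ ↦ σΦ₀` is a well-defined, injective, equivariant map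
`T : Y → Set Z` with `T(y₀) = Φ₀`. [cite: Shimura1998, §8.3 Prop. 28] [cite: Dodson1984, §1 (Remark after the Reflex
Degree Theorem)] -/
theorem exists_typeMap (hst : ∀ g : G, g • y₀ = y₀ ↔ ∀ z : Z, g • z ∈ Φ₀ ↔ z ∈ Φ₀)
    (hY : ∀ y : Y, ∃ g : G, g • y₀ = y) :
    ∃ T : Y → Set Z, (∀ (g : G) (y : Y) (x : Z), x ∈ T (g • y) ↔ g⁻¹ • x ∈ T y) ∧ Function.Injective T ∧
      T y₀ = Φ₀ := by
  classical
  choose σ hσ using hY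
  refine ⟨fun y => {x | (σ y)⁻¹ • x ∈ Φ₀}, fun g y x => ?_, fun y y' hyy' => ?_, ?_⟩
  · -- equivariance: `k = (σ y)⁻¹ g⁻¹ σ(g y)` fixes `y₀`, hence stabilises `Φ₀`
    have hk : ((σ y)⁻¹ * g⁻¹ * σ (g • y)) • y₀ = y₀ := by
      rw [mul_smul, mul_smul, hσ, inv_smul_smul, inv_smul_eq_iff]
      exact (hσ y).symm
    have h1 := (hst _).1 hk ((σ (g • y))⁻¹ • x)
    rw [mul_smul, mul_smul, smul_inv_smul] at h1
    change (σ (g • y))⁻¹ • x ∈ Φ₀ ↔ (σ y)⁻¹ • g⁻¹ • x ∈ Φ₀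
    exact h1.symm
  · -- injectivity: `k = (σ y')⁻¹ σ y` stabilises `Φ₀`, hence fixes `y₀`
    have hk : ∀ z : Z, ((σ y')⁻¹ * σ y) • z ∈ Φ₀ ↔ z ∈ Φ₀ := by
      intro z
      have h1 := congrArg (fun S : Set Z => σ y • z ∈ S) hyy'
      simp only [Set.mem_setOf_eq, inv_smul_smul, eq_iff_iff] at h1
      rw [mul_smul]
      exact h1.symm
    have h2 := (hst _).2 hk
    rw [mul_smul, inv_smul_eq_iff, hσ, hσ] at h2
    exact h2
  · -- base point
    ext x
    simp only [Set.mem_setOf_eq]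
    have h1 := (hst (σ y₀)).1 (hσ y₀) ((σ y₀)⁻¹ • x)
    rw [smul_inv_smul] at h1
    exact h1.symm

/-! ### §2 The types attached to the embeddings of the reflex field -/

/-- `T(g y₀) = gΦ₀`: every attached type is a Galois translate of `Φ₀`. [cite: Dodson1984, §1 (Remark after the
Reflex Degree Theorem)] -/
theorem mem_typeMap_smul_base_iff (hT : ∀ (g : G) (y : Y) (x : Z), x ∈ T (g • y) ↔ g⁻¹ • x ∈ T y)
    (hT₀ : T y₀ = Φ₀) (g : G) (x : Z) : x ∈ T (g • y₀) ↔ g⁻¹ • x ∈ Φ₀ := by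
  rw [hT, hT₀]

/-- **Every attached type `T(y)` is a CM type for `ρ`** (a translate of a CM type is a CM type).
[cite: Shimura1998, §8.3 Prop. 28] -/
theorem isCMTypeWith_typeMap (hΦ : IsCMTypeWith ρ Φ₀)
    (hT : ∀ (g : G) (y : Y) (x : Z), x ∈ T (g • y) ↔ g⁻¹ • x ∈ T y) (hT₀ : T y₀ = Φ₀)
    (hY : ∀ y : Y, ∃ g : G, g • y₀ = y) (y : Y) : IsCMTypeWith ρ (T y) := by
  obtain ⟨g, rfl⟩ := hY y
  refine ⟨fun x => ?_, hΦ.comm, hΦ.invol⟩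
  rw [mem_typeMap_smul_base_iff hT hT₀, mem_typeMap_smul_base_iff hT hT₀, hΦ.comm g⁻¹ x]
  exact hΦ.mem_iff _

/-- `ρx ∈ T(y) ⟺ x ∉ T(y)`. [cite: Shimura1998, §8.3 Prop. 28] -/
theorem rho_smul_mem_typeMap_iff (hΦ : IsCMTypeWith ρ Φ₀)
    (hT : ∀ (g : G) (y : Y) (x : Z), x ∈ T (g • y) ↔ g⁻¹ • x ∈ T y) (hT₀ : T y₀ = Φ₀)
    (hY : ∀ y : Y, ∃ g : G, g • y₀ = y) (y : Y) (x : Z) : ρ • x ∈ T y ↔ x ∉ T y :=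
  (isCMTypeWith_typeMap hΦ hT hT₀ hY y).rho_smul_mem_iff x

/-- **`T(ρy)` is the conjugate type `Z ∖ T(y)`** (complex conjugation on the reflex field).
[cite: Shimura1998, §8.3 Prop. 28] -/
theorem mem_typeMap_rho_smul_iff (hΦ : IsCMTypeWith ρ Φ₀)
    (hT : ∀ (g : G) (y : Y) (x : Z), x ∈ T (g • y) ↔ g⁻¹ • x ∈ T y) (hT₀ : T y₀ = Φ₀)
    (hY : ∀ y : Y, ∃ g : G, g • y₀ = y) (y : Y) (x : Z) : x ∈ T (ρ • y) ↔ x ∉ T y := by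
  have hρ : ρ⁻¹ • x = ρ • x := by rw [inv_smul_eq_iff, hΦ.invol]
  rw [hT, hρ]
  exact rho_smul_mem_typeMap_iff hΦ hT hT₀ hY y x

/-! ### §3 The action on `Y` factors through the action on `Z` -/

/-- **Two elements of `G` with the same action on `Z` have the same action on `Y`** (the Galois action on the reflex
field factors through `Gal(K^c/ℚ)`). [cite: Dodson1984, §1 (Reflex Degree Theorem, proof)] -/
theorem smul_eq_smul_of_forall_smul_eq (hT : ∀ (g : G) (y : Y) (x : Z), x ∈ T (g • y) ↔ g⁻¹ • x ∈ T y)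
    (hTi : Function.Injective T) {g g' : G} (hgg' : ∀ z : Z, g • z = g' • z) (y : Y) : g • y = g' • y := by
  apply hTi
  ext x
  have hx : g⁻¹ • x = g'⁻¹ • x := by rw [eq_inv_smul_iff, ← hgg', smul_inv_smul]
  rw [hT, hT, hx]

/-- `ρρy = y` on `Y`. [cite: Shimura1998, §8.3 Prop. 28] -/
theorem rho_smul_rho_smul (hΦ : IsCMTypeWith ρ Φ₀)
    (hT : ∀ (g : G) (y : Y) (x : Z), x ∈ T (g • y) ↔ g⁻¹ • x ∈ T y) (hTi : Function.Injective T) (y : Y) :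
    ρ • ρ • y = y := by
  rw [← mul_smul]
  rw [show y = (1 : G) • y from (one_smul G y).symm]
  refine (smul_eq_smul_of_forall_smul_eq hT hTi (fun z => ?_) _).trans (by rw [one_smul, one_smul])
  rw [mul_smul, hΦ.invol, one_smul]

/-- `gρy = ρgy` on `Y`. [cite: Shimura1998, §8.3 Prop. 28] -/
theorem smul_rho_smul_comm (hΦ : IsCMTypeWith ρ Φ₀)
    (hT : ∀ (g : G) (y : Y) (x : Z), x ∈ T (g • y) ↔ g⁻¹ • x ∈ T y) (hTi : Function.Injective T) (g : G)
    (y : Y) : g • ρ • y = ρ • g • y := by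
  rw [← mul_smul, ← mul_smul]
  exact smul_eq_smul_of_forall_smul_eq hT hTi (fun z => by rw [mul_smul, mul_smul, hΦ.comm]) y

/-- `ρ` has no fixed point on `Y` (given a point `z` of `Z`: `z` lies in exactly one of `T(y)`, `T(ρy) = Z ∖ T(y)`).
[cite: Shimura1998, §8.3 Prop. 28] -/
theorem rho_smul_ne (hΦ : IsCMTypeWith ρ Φ₀)
    (hT : ∀ (g : G) (y : Y) (x : Z), x ∈ T (g • y) ↔ g⁻¹ • x ∈ T y) (hT₀ : T y₀ = Φ₀)
    (hY : ∀ y : Y, ∃ g : G, g • y₀ = y) (z : Z) (y : Y) : ρ • y ≠ y := by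
  intro h
  have h1 := mem_typeMap_rho_smul_iff hΦ hT hT₀ hY y z
  rw [h] at h1
  exact iff_not_self h1

/-- **A CM type `Ψ ⊆ Y` is a CM type for `ρ`** in the sense of `IsCMTypeWith`, as soon as it contains exactly one of
`y, ρy` for every `y`. [cite: Shimura1998, §8.3 Prop. 28] -/
theorem isCMTypeWith_of_mem_iff (hΦ : IsCMTypeWith ρ Φ₀)
    (hT : ∀ (g : G) (y : Y) (x : Z), x ∈ T (g • y) ↔ g⁻¹ • x ∈ T y) (hTi : Function.Injective T) {Ψ : Set Y}
    (hΨ : ∀ y : Y, y ∈ Ψ ↔ ρ • y ∉ Ψ) : IsCMTypeWith ρ Ψ :=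
  ⟨hΨ, smul_rho_smul_comm hΦ hT hTi, rho_smul_rho_smul hΦ hT hTi⟩

/-! ### §4 Coordinates -/

/-- **A point of `Y` is determined by its coordinates `(x ∈ T y)_{x ∈ Φ₀}`** (two Galois translates of `Φ₀` with the
same trace on `Φ₀` are equal, `Z = Φ₀ ⊔ ρΦ₀`). [cite: Dodson1984, §1 (Remark after the Reflex Degree Theorem)] -/
theorem eq_of_forall_mem_typeMap_iff (hΦ : IsCMTypeWith ρ Φ₀)
    (hT : ∀ (g : G) (y : Y) (x : Z), x ∈ T (g • y) ↔ g⁻¹ • x ∈ T y) (hTi : Function.Injective T)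
    (hT₀ : T y₀ = Φ₀) (hY : ∀ y : Y, ∃ g : G, g • y₀ = y) {y y' : Y}
    (h : ∀ x ∈ Φ₀, x ∈ T y ↔ x ∈ T y') : y = y' := by
  apply hTi
  ext x
  by_cases hx : x ∈ Φ₀
  · exact h x hx
  · have hρx : ρ • x ∈ Φ₀ := (hΦ.rho_smul_mem_iff x).2 hx
    have h1 := h (ρ • x) hρx
    rw [rho_smul_mem_typeMap_iff hΦ hT hT₀ hY, rho_smul_mem_typeMap_iff hΦ hT hT₀ hY] at h1
    tauto

/-- Coordinates of `φy` at a point FIXED by `φ`: `x ∈ T(φy) ⟺ x ∈ T(y)`. [cite: Shimura1998, §8.3 Prop. 28] -/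
theorem mem_typeMap_smul_iff_of_smul_eq (hT : ∀ (g : G) (y : Y) (x : Z), x ∈ T (g • y) ↔ g⁻¹ • x ∈ T y)
    {φ : G} {x : Z} (hφx : φ • x = x) (y : Y) : x ∈ T (φ • y) ↔ x ∈ T y := by
  have h1 : φ⁻¹ • x = x := by rw [inv_smul_eq_iff, hφx]
  rw [hT, h1]

/-- Coordinates of `φy` at a point FLIPPED by `φ` (`φ(ρx) = x`): `x ∈ T(φy) ⟺ x ∉ T(y)`. [cite: Shimura1998, §8.3 Prop. 28] -/
theorem mem_typeMap_smul_iff_of_smul_rho_eq (hΦ : IsCMTypeWith ρ Φ₀)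
    (hT : ∀ (g : G) (y : Y) (x : Z), x ∈ T (g • y) ↔ g⁻¹ • x ∈ T y) (hT₀ : T y₀ = Φ₀)
    (hY : ∀ y : Y, ∃ g : G, g • y₀ = y) {φ : G} {x : Z} (hφx : φ • ρ • x = x) (y : Y) :
    x ∈ T (φ • y) ↔ x ∉ T y := by
  have h1 : φ⁻¹ • x = ρ • x := by rw [inv_smul_eq_iff, hφx]
  rw [hT, h1]
  exact rho_smul_mem_typeMap_iff hΦ hT hT₀ hY y x

/-- A pair flip `φ` at `x` (`φx = ρx`) satisfies `φ(ρx) = x`. [cite: Dodson1984, §5.1] -/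
theorem smul_rho_eq_of_pairFlip (hΦ : IsCMTypeWith ρ Φ₀) {φ : G} {x : Z} (hφx : φ • x = ρ • x) :
    φ • ρ • x = x := by
  rw [hΦ.comm, hφx, hΦ.invol]

/-- **Two elements of `G` agreeing on `Φ₀` agree on `Z`** (`Z = Φ₀ ⊔ ρΦ₀` and the action commutes with `ρ`), hence on
`Y`. [cite: Shimura1998, §8.3 Prop. 28] -/
theorem forall_smul_eq_of_forall_mem (hΦ : IsCMTypeWith ρ Φ₀) {g g' : G} (h : ∀ x ∈ Φ₀, g • x = g' • x) (z : Z) :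
    g • z = g' • z := by
  by_cases hz : z ∈ Φ₀
  · exact h z hz
  · have hρz : ρ • z ∈ Φ₀ := (hΦ.rho_smul_mem_iff z).2 hz
    have h1 := h (ρ • z) hρz
    rw [hΦ.comm, hΦ.comm g'] at h1
    simpa [hΦ.invol] using congrArg (fun w => ρ • w) h1

/-- The type attached to `y₀` itself: `x ∈ T(y₀) ⟺ x ∈ Φ₀`. [cite: Shimura1998, §8.3 Prop. 28] -/
theorem mem_typeMap_base_iff (hT₀ : T y₀ = Φ₀) (x : Z) : x ∈ T y₀ ↔ x ∈ Φ₀ := by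
  rw [hT₀]

/-- **Stabiliser identity recovered from `T`**: `g` fixes `y₀` iff `g` stabilises `Φ₀`.
[cite: Shimura1998, §8.3 Prop. 28] -/
theorem smul_base_eq_iff (hT : ∀ (g : G) (y : Y) (x : Z), x ∈ T (g • y) ↔ g⁻¹ • x ∈ T y)
    (hTi : Function.Injective T) (hT₀ : T y₀ = Φ₀) (g : G) :
    g • y₀ = y₀ ↔ ∀ z : Z, g • z ∈ Φ₀ ↔ z ∈ Φ₀ := by
  constructor
  · intro hg z
    have h1 := mem_typeMap_smul_base_iff hT hT₀ g (g • z)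
    rw [hg, hT₀, inv_smul_smul] at h1
    exact h1
  · intro hg
    apply hTi
    ext x
    rw [mem_typeMap_smul_base_iff hT hT₀, hT₀]
    have h1 := hg (g⁻¹ • x)
    rw [smul_inv_smul] at h1
    exact h1.symm

end ReflexSlot

end Literature.NumberTheory.ComplexMultiplication
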